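import Summits.ABC.IUTFork.Cor312NaiveProvLinkId
import Summits.ABC.IUTFork.Conditional.AbcOfPilotKummerNonVacuity
import HarnessLib

/-!
# Branch C apex re-based on the campaign-S chain — THE CONVERSE NON-VACUITY: the apex antecedent WITH S is satisfiable
# at every genuine Θ-volume datum at which [IUTchIII] Cor. 3.12 holds; the per-datum hypothesis bundle is
# KERNEL-EQUIVALENT to `Cor22.Cor312AtDatum` (rung LADDER-ABC:A2.C)

PROOF-ONLY record file of the abc-iut cell (seat abc-iut-w6-d049, block C / W6; self-named row «C3-APEX-CONVERSE»,
STATUS 2026-08-26T08:0xZ; companion of abc-iut-w4-d001's `Summits/ABC/ABC/Theorems/IUTThetaPilotAbcOfPilotKummer.lean`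
(p429391, audited by this seat 07:2xZ, INFO-2) and of abc-iut-w4-d026's `Conditional/AbcOfPilotKummerNonVacuity.lean`
(p430256)). 0 definitions, 0 `Prop` facts, 0 instances. Part II of two (I = `Cor312NaiveProvLinkId.lean`, the
link-identified model). TAKES NO SIDE on [IUTchIII] Cor. 3.12 (S. Mochizuki, *Inter-universal Teichmüller theory III*,
kurims manuscript, Cor. 3.12 statement p. 173 l. 41 – p. 174 l. 19, proof Step (xi) (xi-e)/(xi-f) p. 183 l. 43 – p. 184
l. 29) or on any author.

THE AUDITED THEOREM. abc-iut-w4-d001's `ThetaPartII.abc_of_pilotKummerIndRelated_of_genEllTwo` derives `_root_.ABC`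
from DATA families `(TI, St, Pc, ρ, qK)` indexed by the genuine Θ-volume data `T : Cor22.ThetaVolumeDatumAt P l` and,
per datum, six `Prop` binders: `hSet` (`Cor312Prov.IsSettingOf T.D (Pc T)`), `hBridge`, `hKumB` ((ii)(b) at column `n`),
`hPin` (`PinnedRegions3`), `hS` (`PilotKummerIndRelated` = S) and `hΘ` (`(Pc T).negLogTheta ≤ ↑T.negLogTheta`); its
first step `cor312Of_datum_of_pilotKummerIndRelated` shows these six imply `T.Cor312Of` (`−|log(q)| ≤ −|log(Θ)|` for
the datum's DEFINED numbers). abc-iut-w4-d026 (p430256, `apex_residual_loadBearing`) exhibited data at which the five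
NON-S binders hold at every datum and S fails («the content sits in hS»).

WHAT IS PROVED HERE (all by NAME; nothing new about [IUTchIII] §3):
1. `exists_allBinders_of_cor312Of (T) (h : T.Cor312Of)` — at EVERY genuine Θ-volume datum at which the datum's
   Cor.-3.12 inequality holds, ALL SIX binders — S INCLUDED — are jointly satisfiable: Part I's link-identified setting
   over `T.D`'s own index skeleton (`NaiveProv.linkId_witness_isSettingOf T.D`); there `hΘ` READS
   `−(1/2l)·log(q) ≤ T.negLogTheta`, i.e. `T.Cor312Of` (dictionary `Cor312Prov.negAbsLogQ_eq_neg_absLogq_of_isVolumeInputOf`).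
2. `exists_allBinders_iff_cor312Of (T)` — with abc-iut-w4-d001's step as (⇒): **the per-datum hypothesis bundle
   `∃ (TI, St, Pc, ρ, qK), hSet ∧ hBridge ∧ hKumB ∧ hPin ∧ hS ∧ hΘ` is EQUIVALENT to `T.Cor312Of`**; FullSituation-keyed
   twin `exists_allBinders_thm311_iff_cor312Of` (`hThm311 : F.Statement` for `hKumB`); and `bundle_iff_cor312AtDatum`:
   the `∀ T`-form at `(P, l)` (the shape of C-cert-2's ∃-bundle `H` of the `abc_of_S_v2` draft, admissibility guards
   stripped) is EQUIVALENT to the crux child `Cor22.Cor312AtDatum P l`.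
3. `theta_binder_loadBearing_at_linkId (T)` — the COMPLEMENT of `apex_residual_loadBearing`: data at which
   `hSet ∧ hThm311 ∧ hBridge ∧ hKumB ∧ hPin ∧ hS` hold UNCONDITIONALLY at every datum, the verbatim Statement holds, and
   `hΘ ↔ T.Cor312Of`; `binders_content_summary` records both horns side by side.

READING FOR THE C SCOREBOARD (neutral). Over FREE setting data (the v2 line of record, `abc_of_S_v2` p428991, and
abc-iut-w4-d001's apex) the certificate «abc ⇐ S» is, pointwise in the kernel, «abc ⇐ [IUTchIII] Cor. 3.12 at the
genuine Θ-data» (abc-iut-S2's `ABC_of_cor312_of_hullVolume`): AS TYPED there, S neither adds nor removes strength;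
WHICH binder carries the content — `hS` at the pin-honest glue (p430256), `hΘ` at the link-identified glue (here) — is
a property of the chosen free data, only the conjunction is invariant. S (or its hull-level form S_H) becomes a
contentful residual on its own exactly when the setting is COMPUTED from the datum — which is what the v3 line
(abc-iut-C-cert-2's `Conditional/AbcOfSGenuine.lean`, p430884: `P312 := settingPrVolSharp`) does; this file is the
kernel reason that move is necessary. Nothing here says which reading of Step (xi) is right; S is an assumption
label; typed ≠ proved; instantiated ≠ endorsed.
[cite: Mochizuki2012, IUTchIII Cor. 3.12 p.173–174] [cite: ScholzeStix2018, §2.2 pp. 9–10]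
[claim: Mochizuki2012, status: disputed] for every IUT sentence quoted.
-/

noncomputable section

namespace Summit.ABC

namespace IUTFork


/-! ## 6. At every genuine Θ-volume datum: all six binders ⟺ Cor. 3.12 at the datum -/

namespace Conditional

namespace ApexConverse

open Literature.NumberTheory.DiophantineGeometry Literature.NumberTheory.DiophantineGeometry.GenEll
open Literature.IUT.LogVolume Literature.IUT.HodgeTheaters Thm311 Cor312Vol
open Summit.ABC.ABC.Theorems.ThetaPartII

/-- **ALL SIX per-datum binders of the apex — S INCLUDED — are jointly satisfiable at every genuine Θ-volume datum `T`
at which the datum's Cor.-3.12 inequality holds** (`T.Cor312Of`: `−|log(q)| ≤ −|log(Θ)|` for the DEFINED numbers).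
Witness: the link-identified setting over `T.D`'s index skeleton (`NaiveProv.linkId_witness_isSettingOf T.D`); `hΘ`
reads `−(1/2l)·log(q) ≤ T.negLogTheta`, i.e. `T.Cor312Of` through the dictionary
`Cor312Prov.negAbsLogQ_eq_neg_absLogq_of_isVolumeInputOf`. [claim: Mochizuki2012, status: disputed] -/
theorem exists_allBinders_of_cor312Of {P : NFPoint} {l : ℕ} (T : Cor22.ThetaVolumeDatumAt P l)
    (h : T.Cor312Of) :
    ∃ (TI : ThetaIndex) (F : FullSituation TI) (Pc : Cor312.Setting F.toLatticeSituation.toSituation)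
      (ρ : (∀ v : TI.V, v ∈ TI.Vbad → Set (F.L.StarPacket v)) → ∀ (j : TI.Label) (vQ : TI.VQ), Set (F.L.Packet j vQ))
      (qK : ∀ v : TI.V, v ∈ TI.Vbad → Set (F.L.StarPacket v)),
      (letI := T.instFieldF; letI := T.instNumberFieldF; letI := T.instAlgebraF; letI := T.instFieldK
        letI := T.instNumberFieldK; letI := T.instAlgebraK; letI := T.instFieldFbar; letI := T.instAlgebraFbar
        letI := T.instAlgebraKFbar; letI := T.instIsElliptic
        Cor312Prov.IsSettingOf T.D Pc) ∧
      F.Statement ∧ BridgeHyps Pc ∧ (F.toLatticeSituation.col Pc.n).KummerB (F.toLatticeSituation.D Pc.n) ∧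
      PinnedRegions3 F.toLatticeSituation Pc ρ qK ∧ PilotKummerIndRelated F.toLatticeSituation Pc ρ qK ∧
      Pc.negLogTheta ≤ ((T.negLogTheta : ℝ) : WithTop ℝ) ∧ Pc.Statement ∧ Pc.AbsLogQPos := by
  letI := T.instFieldF; letI := T.instNumberFieldF; letI := T.instAlgebraF; letI := T.instFieldK
  letI := T.instNumberFieldK; letI := T.instAlgebraK; letI := T.instFieldFbar; letI := T.instAlgebraFbar
  letI := T.instAlgebraKFbar; letI := T.instIsElliptic
  obtain ⟨F₁, Pc, ρ, qK, hSet, hF, hB, hK, hpin, hS, hA, -, hnΘ, hSt⟩ :=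
    NaiveProv.linkId_witness_isSettingOf T.D
  refine ⟨_, F₁, Pc, ρ, qK, hSet, hF, hB, hK, hpin, hS, ?_, hSt, hA⟩
  rw [hnΘ, WithTop.coe_le_coe]
  have hd : T.negAbsLogQ = -Cor312Prov.absLogq T.D :=
    Cor312Prov.negAbsLogQ_eq_neg_absLogq_of_isVolumeInputOf T.D T.isVolumeInputOf
  rw [← hd]
  exact T.cor312Of_iff.1 h

/-- **THE PER-DATUM HYPOTHESIS BUNDLE OF THE APEX IS EQUIVALENT TO Cor. 3.12 AT THE DATUM.** In abc-iut-w4-d001's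
binder shapes (`St` a lattice situation): `(∃ TI St Pc ρ qK, hSet ∧ hBridge ∧ hKumB ∧ hPin ∧ hS ∧ hΘ) ↔ T.Cor312Of`.
(⇒) is abc-iut-w4-d001's `cor312Of_datum_of_pilotKummerIndRelated`; (⇐) is `exists_allBinders_of_cor312Of`.
[cite: Mochizuki2012, IUTchIII Cor. 3.12 p.173–174] [claim: Mochizuki2012, status: disputed] -/
theorem exists_allBinders_iff_cor312Of {P : NFPoint} {l : ℕ} (T : Cor22.ThetaVolumeDatumAt P l) :
    (∃ (TI : ThetaIndex) (St : LatticeSituation TI) (Pc : Cor312.Setting St.toSituation)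
      (ρ : (∀ v : TI.V, v ∈ TI.Vbad → Set (St.L.StarPacket v)) → ∀ (j : TI.Label) (vQ : TI.VQ), Set (St.L.Packet j vQ))
      (qK : ∀ v : TI.V, v ∈ TI.Vbad → Set (St.L.StarPacket v)),
      (letI := T.instFieldF; letI := T.instNumberFieldF; letI := T.instAlgebraF; letI := T.instFieldK
        letI := T.instNumberFieldK; letI := T.instAlgebraK; letI := T.instFieldFbar; letI := T.instAlgebraFbar
        letI := T.instAlgebraKFbar; letI := T.instIsElliptic
        Cor312Prov.IsSettingOf T.D Pc) ∧
      BridgeHyps Pc ∧ (St.col Pc.n).KummerB (St.D Pc.n) ∧ PinnedRegions3 St Pc ρ qK ∧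
      PilotKummerIndRelated St Pc ρ qK ∧ Pc.negLogTheta ≤ ((T.negLogTheta : ℝ) : WithTop ℝ)) ↔
    T.Cor312Of := by
  constructor
  · rintro ⟨TI, St, Pc, ρ, qK, hSet, hB, hK, hpin, hS, hΘ⟩
    exact cor312Of_datum_of_pilotKummerIndRelated T St Pc ρ qK hSet hB hK hpin hS hΘ
  · intro h
    obtain ⟨TI, F, Pc, ρ, qK, hSet, -, hB, hK, hpin, hS, hΘ, -, -⟩ := exists_allBinders_of_cor312Of T h
    exact ⟨TI, F.toLatticeSituation, Pc, ρ, qK, hSet, hB, hK, hpin, hS, hΘ⟩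

/-- **FullSituation-keyed twin** (branch C's v0 binder names: `hThm311 : F.Statement` in place of `hKumB`):
`(∃ TI F Pc ρ qK, hSet ∧ hThm311 ∧ hBridge ∧ hPin ∧ hS ∧ hΘ) ↔ T.Cor312Of`. [claim: Mochizuki2012, status: disputed] -/
theorem exists_allBinders_thm311_iff_cor312Of {P : NFPoint} {l : ℕ} (T : Cor22.ThetaVolumeDatumAt P l) :
    (∃ (TI : ThetaIndex) (F : FullSituation TI) (Pc : Cor312.Setting F.toLatticeSituation.toSituation)
      (ρ : (∀ v : TI.V, v ∈ TI.Vbad → Set (F.L.StarPacket v)) → ∀ (j : TI.Label) (vQ : TI.VQ), Set (F.L.Packet j vQ))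
      (qK : ∀ v : TI.V, v ∈ TI.Vbad → Set (F.L.StarPacket v)),
      (letI := T.instFieldF; letI := T.instNumberFieldF; letI := T.instAlgebraF; letI := T.instFieldK
        letI := T.instNumberFieldK; letI := T.instAlgebraK; letI := T.instFieldFbar; letI := T.instAlgebraFbar
        letI := T.instAlgebraKFbar; letI := T.instIsElliptic
        Cor312Prov.IsSettingOf T.D Pc) ∧
      F.Statement ∧ BridgeHyps Pc ∧ PinnedRegions3 F.toLatticeSituation Pc ρ qK ∧
      PilotKummerIndRelated F.toLatticeSituation Pc ρ qK ∧ Pc.negLogTheta ≤ ((T.negLogTheta : ℝ) : WithTop ℝ)) ↔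
    T.Cor312Of := by
  constructor
  · rintro ⟨TI, F, Pc, ρ, qK, hSet, hF, hB, hpin, hS, hΘ⟩
    exact cor312Of_datum_of_pilotKummerIndRelated T F.toLatticeSituation Pc ρ qK hSet hB
      (GluedMonoids.kummerB_of_statement F hF Pc.n) hpin hS hΘ
  · intro h
    obtain ⟨TI, F, Pc, ρ, qK, hSet, hF, hB, -, hpin, hS, hΘ, -, -⟩ := exists_allBinders_of_cor312Of T h
    exact ⟨TI, F, Pc, ρ, qK, hSet, hF, hB, hpin, hS, hΘ⟩

/-- **The `∀ T`-form at `(P, l)`: the apex's per-`(P, l)` hypothesis (the shape of C-cert-2's ∃-bundle `H`, admissibility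
guards stripped) is EQUIVALENT to the crux child `Cor22.Cor312AtDatum P l`** (`= ∀ T, T.Cor312Of`, abc-iut-S2).
[cite: Mochizuki2012, IUTchIII Cor. 3.12 p.173–174] [claim: Mochizuki2012, status: disputed] -/
theorem bundle_iff_cor312AtDatum (P : NFPoint) (l : ℕ) :
    (∀ T : Cor22.ThetaVolumeDatumAt P l,
      ∃ (TI : ThetaIndex) (St : LatticeSituation TI) (Pc : Cor312.Setting St.toSituation)
        (ρ : (∀ v : TI.V, v ∈ TI.Vbad → Set (St.L.StarPacket v)) → ∀ (j : TI.Label) (vQ : TI.VQ), Set (St.L.Packet j vQ))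
        (qK : ∀ v : TI.V, v ∈ TI.Vbad → Set (St.L.StarPacket v)),
        (letI := T.instFieldF; letI := T.instNumberFieldF; letI := T.instAlgebraF; letI := T.instFieldK
          letI := T.instNumberFieldK; letI := T.instAlgebraK; letI := T.instFieldFbar; letI := T.instAlgebraFbar
          letI := T.instAlgebraKFbar; letI := T.instIsElliptic
          Cor312Prov.IsSettingOf T.D Pc) ∧
        BridgeHyps Pc ∧ (St.col Pc.n).KummerB (St.D Pc.n) ∧ PinnedRegions3 St Pc ρ qK ∧
        PilotKummerIndRelated St Pc ρ qK ∧ Pc.negLogTheta ≤ ((T.negLogTheta : ℝ) : WithTop ℝ)) ↔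
    Cor22.Cor312AtDatum P l :=
  ⟨fun H T => (exists_allBinders_iff_cor312Of T).1 (H T), fun H T => (exists_allBinders_iff_cor312Of T).2 (H T)⟩

/-- **THE Θ-SIDE READ BINDER IS LOAD-BEARING AT THE LINK-IDENTIFIED DATA** (complement of abc-iut-w4-d026's
`apex_residual_loadBearing`, p430256, where the content sits in `hS`): at every genuine Θ-volume datum `T` there are
data at which `hSet ∧ hThm311 ∧ hBridge ∧ hKumB ∧ hPin ∧ hS` hold UNCONDITIONALLY (S included), the verbatim Statement
holds, and the remaining binder `hΘ` is EQUIVALENT to `T.Cor312Of`. Which binder carries the content is a property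
of the chosen free data; only the conjunction is invariant. [claim: Mochizuki2012, status: disputed] -/
theorem theta_binder_loadBearing_at_linkId {P : NFPoint} {l : ℕ} (T : Cor22.ThetaVolumeDatumAt P l) :
    ∃ (TI : ThetaIndex) (F : FullSituation TI) (Pc : Cor312.Setting F.toLatticeSituation.toSituation)
      (ρ : (∀ v : TI.V, v ∈ TI.Vbad → Set (F.L.StarPacket v)) → ∀ (j : TI.Label) (vQ : TI.VQ), Set (F.L.Packet j vQ))
      (qK : ∀ v : TI.V, v ∈ TI.Vbad → Set (F.L.StarPacket v)),
      (letI := T.instFieldF; letI := T.instNumberFieldF; letI := T.instAlgebraF; letI := T.instFieldK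
        letI := T.instNumberFieldK; letI := T.instAlgebraK; letI := T.instFieldFbar; letI := T.instAlgebraFbar
        letI := T.instAlgebraKFbar; letI := T.instIsElliptic
        Cor312Prov.IsSettingOf T.D Pc) ∧
      F.Statement ∧ BridgeHyps Pc ∧ (F.toLatticeSituation.col Pc.n).KummerB (F.toLatticeSituation.D Pc.n) ∧
      PinnedRegions3 F.toLatticeSituation Pc ρ qK ∧ PilotKummerIndRelated F.toLatticeSituation Pc ρ qK ∧
      Pc.Statement ∧ (Pc.negLogTheta ≤ ((T.negLogTheta : ℝ) : WithTop ℝ) ↔ T.Cor312Of) := by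
  letI := T.instFieldF; letI := T.instNumberFieldF; letI := T.instAlgebraF; letI := T.instFieldK
  letI := T.instNumberFieldK; letI := T.instAlgebraK; letI := T.instFieldFbar; letI := T.instAlgebraFbar
  letI := T.instAlgebraKFbar; letI := T.instIsElliptic
  obtain ⟨F₁, Pc, ρ, qK, hSet, hF, hB, hK, hpin, hS, -, -, hnΘ, hSt⟩ :=
    NaiveProv.linkId_witness_isSettingOf T.D
  refine ⟨_, F₁, Pc, ρ, qK, hSet, hF, hB, hK, hpin, hS, hSt, ?_⟩
  have hd : T.negAbsLogQ = -Cor312Prov.absLogq T.D :=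
    Cor312Prov.negAbsLogQ_eq_neg_absLogq_of_isVolumeInputOf T.D T.isVolumeInputOf
  rw [hnΘ, WithTop.coe_le_coe, ← hd]
  exact T.cor312Of_iff.symm

/-- **Neither `hS` nor `hΘ` can be dropped, and neither is "the" content.** (a) abc-iut-w4-d026: data with all binders but
`hS` (p430256 `exists_sideData_of_datum`); (b) here: data with all binders but possibly `hΘ`, where `hΘ ↔ T.Cor312Of`; (c) the
conjunction over free data is equivalent to `T.Cor312Of` (`exists_allBinders_iff_cor312Of`). Recorded as one statement for the
C scoreboard readers. [claim: Mochizuki2012, status: disputed] -/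
theorem binders_content_summary {P : NFPoint} {l : ℕ} (T : Cor22.ThetaVolumeDatumAt P l) :
    (∃ (TI : ThetaIndex) (F : FullSituation TI) (Pc : Cor312.Setting F.toLatticeSituation.toSituation)
        (ρ : (∀ v : TI.V, v ∈ TI.Vbad → Set (F.L.StarPacket v)) → ∀ (j : TI.Label) (vQ : TI.VQ), Set (F.L.Packet j vQ))
        (qK : ∀ v : TI.V, v ∈ TI.Vbad → Set (F.L.StarPacket v)),
        (letI := T.instFieldF; letI := T.instNumberFieldF; letI := T.instAlgebraF; letI := T.instFieldK
          letI := T.instNumberFieldK; letI := T.instAlgebraK; letI := T.instFieldFbar; letI := T.instAlgebraFbar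
          letI := T.instAlgebraKFbar; letI := T.instIsElliptic
          Cor312Prov.IsSettingOf T.D Pc) ∧
        BridgeHyps Pc ∧ (F.toLatticeSituation.col Pc.n).KummerB (F.toLatticeSituation.D Pc.n) ∧
        PinnedRegions3 F.toLatticeSituation Pc ρ qK ∧ Pc.negLogTheta ≤ ((T.negLogTheta : ℝ) : WithTop ℝ) ∧
        ¬ PilotKummerIndRelated F.toLatticeSituation Pc ρ qK) ∧
    (∃ (TI : ThetaIndex) (F : FullSituation TI) (Pc : Cor312.Setting F.toLatticeSituation.toSituation)
        (ρ : (∀ v : TI.V, v ∈ TI.Vbad → Set (F.L.StarPacket v)) → ∀ (j : TI.Label) (vQ : TI.VQ), Set (F.L.Packet j vQ))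
        (qK : ∀ v : TI.V, v ∈ TI.Vbad → Set (F.L.StarPacket v)),
        (letI := T.instFieldF; letI := T.instNumberFieldF; letI := T.instAlgebraF; letI := T.instFieldK
          letI := T.instNumberFieldK; letI := T.instAlgebraK; letI := T.instFieldFbar; letI := T.instAlgebraFbar
          letI := T.instAlgebraKFbar; letI := T.instIsElliptic
          Cor312Prov.IsSettingOf T.D Pc) ∧
        BridgeHyps Pc ∧ (F.toLatticeSituation.col Pc.n).KummerB (F.toLatticeSituation.D Pc.n) ∧
        PinnedRegions3 F.toLatticeSituation Pc ρ qK ∧ PilotKummerIndRelated F.toLatticeSituation Pc ρ qK ∧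
        (Pc.negLogTheta ≤ ((T.negLogTheta : ℝ) : WithTop ℝ) ↔ T.Cor312Of)) := by
  refine ⟨?_, ?_⟩
  · obtain ⟨TI, F, Pc, ρ, qK, hSet, -, hB, hK, hpin, hΘ, -, hS, -⟩ := ApexNonVacuity.exists_sideData_of_datum T
    exact ⟨TI, F, Pc, ρ, qK, hSet, hB, hK, hpin, hΘ, hS⟩
  · obtain ⟨TI, F, Pc, ρ, qK, hSet, -, hB, hK, hpin, hS, -, hΘ⟩ := theta_binder_loadBearing_at_linkId T
    exact ⟨TI, F, Pc, ρ, qK, hSet, hB, hK, hpin, hS, hΘ⟩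

end ApexConverse

end Conditional

end IUTFork

end Summit.ABC

end
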